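import Summits.KontsevichZagierPeriods.Zeta5Search.LaiSweepShard

/-!
# `κ₃` sweep certificate — shard file 047 of 127 (shards 329–335 of 889)

HONEST FRAMING. Systematic search; no irrationality claim unless certified. This file only checks,
by `decide +kernel`, shards 329–335 of the order-cell sweep of the `κ₃` point `(74, 2180, 444; δ74)`
(engine `LaiSweepEngine`, soundness `LaiSweepJump/Free/Eval/Shard/Kappa3`; a shard is `⟨regime, n,
p, q, p', q', Lo, Up⟩`: `n` cells from `p/q` to `p'/q'` with integer rate sums in `[Lo, Up]`, `K =
128`, `D = 2^40`). It draws NO conclusion: only the capstone `LaiKappa3SweepCert`, which needs all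
127 shard files, does. Kernel cost of this file ≈ 560 cells × 0.3 s.
-/

namespace Summit.KontsevichZagierPeriods.Zeta5Search.Sweep

set_option maxHeartbeats 100000000 in
/-- Shard 329: 80 cells of regime B from `71/240` to `71/239`.
[cite: Lai2024BallRivoal, §4 Lemma 4.3] -/
theorem shard329 :
    Shard.check 128 (2^40)
      ⟨true, 80, 71, 240, 71, 239, 22533363105322, 24101142999453⟩ = true := by
  decide +kernel

set_option maxHeartbeats 100000000 in
/-- Shard 330: 80 cells of regime B from `71/239` to `54/181`.
[cite: Lai2024BallRivoal, §4 Lemma 4.3] -/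
theorem shard330 :
    Shard.check 128 (2^40)
      ⟨true, 80, 71, 239, 54, 181, 23061741271893, 24681404430052⟩ = true := by
  decide +kernel

set_option maxHeartbeats 100000000 in
/-- Shard 331: 80 cells of regime B from `54/181` to `1439/4804`.
[cite: Lai2024BallRivoal, §4 Lemma 4.3] -/
theorem shard331 :
    Shard.check 128 (2^40)
      ⟨true, 80, 54, 181, 1439, 4804, 21638918518317, 23172540606624⟩ = true := by
  decide +kernel

set_option maxHeartbeats 100000000 in
/-- Shard 332: 80 cells of regime B from `1439/4804` to `105/349`.
[cite: Lai2024BallRivoal, §4 Lemma 4.3] -/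
theorem shard332 :
    Shard.check 128 (2^40)
      ⟨true, 80, 1439, 4804, 105, 349, 23705939221665, 25405102828650⟩ = true := by
  decide +kernel

set_option maxHeartbeats 100000000 in
/-- Shard 333: 80 cells of regime B from `105/349` to `129/427`.
[cite: Lai2024BallRivoal, §4 Lemma 4.3] -/
theorem shard333 :
    Shard.check 128 (2^40)
      ⟨true, 80, 105, 349, 129, 427, 22378080570651, 23994876648580⟩ = true := by
  decide +kernel

set_option maxHeartbeats 100000000 in
/-- Shard 334: 80 cells of regime B from `129/427` to `27/89`.
[cite: Lai2024BallRivoal, §4 Lemma 4.3] -/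
theorem shard334 :
    Shard.check 128 (2^40)
      ⟨true, 80, 129, 427, 27, 89, 22576674382648, 24223346934223⟩ = true := by
  decide +kernel

set_option maxHeartbeats 100000000 in
/-- Shard 335: 80 cells of regime B from `27/89` to `85/279`.
[cite: Lai2024BallRivoal, §4 Lemma 4.3] -/
theorem shard335 :
    Shard.check 128 (2^40)
      ⟨true, 80, 27, 89, 85, 279, 22939851166509, 24629249033697⟩ = true := by
  decide +kernel

/-- The checked shards of this file, in order. [folklore] -/
def shards047 : List (CheckedShard 128 (2^40)) :=
  [⟨_, shard329⟩, ⟨_, shard330⟩, ⟨_, shard331⟩, ⟨_, shard332⟩, ⟨_, shard333⟩,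
    ⟨_, shard334⟩, ⟨_, shard335⟩]

end Summit.KontsevichZagierPeriods.Zeta5Search.Sweep
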